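import Literature.Topology.FourManifolds.ReducibleTrisectionNonSeparatingPi1
import HarnessLib

/-!
# The `π₁`-obstruction to a non-separating reducing curve, from side functions read in flat
# charts of the central surface

Topic `Literature/Topology/FourManifolds`; continuation of
`ReducibleTrisectionNonSeparatingPi1.lean` (`IsGKTrisection.not_simplyConnectedSpace_of_sideFunctions`:
the `π₁`-shadow of Aranda–Zupan's splitting `X = X′ # (S¹ × S³)` along a non-separating
reducing curve `δ`, arXiv:2503.04607 §2 p. 6, assembled from side functions of the three
compressing discs, a compatibility neighbourhood `A` of `δ` and a crossing arc).  **Everything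
here is proved; no definitions, no named facts.**

This file removes the last two *global* inputs.  It is enough to know the side functions
LOCALLY along `δ`, in charts of the central surface `F` flattening `δ`:

**Theorem (`IsGKTrisection.not_simplyConnectedSpace_of_sideCharts`).**  With `D_q`, `O_q`,
`σ_q` as in `…_of_sideFunctions`, suppose that every point `p ∈ δ` has an open partial
homeomorphism `e` from the subspace `F` to `ℝ × ℝ` with `p ∈ e.source`, `e p = 0`,
`δ ∩ e.source = {second coordinate = 0}`, and such that for each `q` there is a sign
`ε = ±1` with `σ_q = ε` where the second coordinate is `> 0` and `σ_q = -ε` where it is `< 0`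
(the two sides of `δ` in `F` lie on opposite sides of every disc).  Then `X` is not simply
connected.

The compatibility neighbourhood comes from a lemma of general topology
(`exists_open_forall_eq_of_local`: a function which is locally constant off a connected set `δ`
near `δ`, with `δ` nowhere dense, is constant on `A ∖ δ` for an open `A ⊇ δ` — here applied to
the products `σ_q σ_0`), and the crossing arc is the segment `s ↦ e⁻¹ (0, ± r (2s - 1))` of a
chart at one point of `δ`.  What is left for
`Trisection.not_simplyConnectedSpace_of_reducing_nonseparating` is the construction, from the
three smoothly embedded compressing discs (`Trisection.BoundsDisc`), of side functions near the
discs and of flat charts of `(F, δ)` in which they have this sign pattern.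

## References

* R. Aranda, A. Zupan, *Manifolds with weakly reducible genus-three trisections are standard*,
  arXiv:2503.04607 (2025), §2 p. 6. [ArandaZupan2025]
* A. Hatcher, *Algebraic Topology*, CUP (2002), Thm. 1.7 (p. 29). [HatcherAT2002]
-/

noncomputable section

open Set Function Filter Topology Metric
open scoped Manifold ContDiff unitInterval

namespace Literature.Topology.FourManifolds

open Literature.AlgebraicTopology.FundamentalGroup

universe u

/-! ### A locally constant germ along a connected nowhere dense set is constant near it -/

section LocallyConstant

variable {Y : Type*} [TopologicalSpace Y]

/-- **A function locally constant off `δ` near each point of `δ` is constant near `δ`**, when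
`δ` is connected and nowhere dense: if every `p ∈ δ` has a neighbourhood `W` and a value `κ_p`
with `τ = κ_p` on `W ∖ δ`, then `τ` is constant on `A ∖ δ` for some open `A ⊇ δ` (the values
`κ_p` agree at nearby points of `δ` because the two neighbourhoods share a point off `δ`, so
`p ↦ κ_p` is locally constant on the connected `δ`). [folklore] -/
theorem exists_open_forall_eq_of_local {δ : Set Y} (hδ : IsPreconnected δ)
    (hnd : ∀ p ∈ δ, ∀ V ∈ 𝓝 p, (V \ δ).Nonempty) {τ : Y → ℝ}
    (hloc : ∀ p ∈ δ, ∃ W ∈ 𝓝 p, ∃ κ : ℝ, ∀ y ∈ W \ δ, τ y = κ) :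
    ∃ A : Set Y, IsOpen A ∧ δ ⊆ A ∧ ∃ κ : ℝ, ∀ y ∈ A \ δ, τ y = κ := by
  classical
  rcases δ.eq_empty_or_nonempty with hδe | ⟨p₀, hp₀⟩
  · exact ⟨∅, isOpen_empty, by rw [hδe], 0, fun y hy => absurd hy.1 (notMem_empty _)⟩
  choose! W hW κ hκ using hloc
  -- open neighbourhoods
  set W' : Y → Set Y := fun p => interior (W p) with hW'
  have hW'o : ∀ p, IsOpen (W' p) := fun p => isOpen_interior
  have hpW' : ∀ p ∈ δ, p ∈ W' p := fun p hp => mem_interior_iff_mem_nhds.2 (hW p hp)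
  -- `κ` is locally constant along `δ`
  have hκloc : ∀ p ∈ δ, ∀ p' ∈ δ, p' ∈ W' p → κ p' = κ p := by
    intro p hp p' hp' hp'W
    have hV : W' p ∩ W' p' ∈ 𝓝 p' :=
      inter_mem ((hW'o p).mem_nhds hp'W) ((hW'o p').mem_nhds (hpW' p' hp'))
    obtain ⟨y, ⟨hy, hy'⟩, hyδ⟩ := hnd p' hp' _ hV
    rw [← hκ p' hp' y ⟨interior_subset hy', hyδ⟩, ← hκ p hp y ⟨interior_subset hy, hyδ⟩]
  -- hence constant on the connected `δ` (through a `Bool`-valued continuous function)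
  have hκconst : ∀ p ∈ δ, κ p = κ p₀ := by
    intro p hp
    set f : Y → Bool := fun y => decide (κ y = κ p₀) with hf
    have hfc : ContinuousOn f δ := by
      intro y hy
      have hev : f =ᶠ[𝓝[δ] y] fun _ => f y := by
        have h1 : W' y ∈ 𝓝[δ] y := mem_nhdsWithin_of_mem_nhds ((hW'o y).mem_nhds (hpW' y hy))
        filter_upwards [h1, self_mem_nhdsWithin] with y' hy'W hy'δ
        simp only [hf, hκloc y hy y' hy'δ hy'W]
      exact continuousWithinAt_const.congr_of_eventuallyEq hev rfl
    have := hδ.constant hfc hp hp₀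
    have h2 : f p = true := this.trans (by simp [hf])
    simpa [hf] using h2
  refine ⟨⋃ p ∈ δ, W' p, isOpen_biUnion fun p _ => hW'o p, fun p hp => mem_biUnion hp (hpW' p hp),
    κ p₀, fun y hy => ?_⟩
  obtain ⟨p, hp, hyp⟩ := mem_iUnion₂.1 hy.1
  rw [hκ p hp y ⟨interior_subset hyp, hy.2⟩, hκconst p hp]

end LocallyConstant

/-! ### The obstruction from flat charts of `(F, δ)` -/

section Charts

variable {X : Type u} [TopologicalSpace X] [T2Space X] [SecondCountableTopology X]
  [ChartedSpace (EuclideanSpace ℝ (Fin 4)) X] {g : ℕ} {k : Fin 3 → ℕ} {S : Fin 3 → Set X}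

omit [T2Space X] [SecondCountableTopology X] in
/-- A curve on the central surface is connected (a continuous image of the circle).
[cite: ArandaZupan2025, §2 (p. 3)] -/
theorem Trisection.IsCurve.isConnected {δ : Set X} (hc : Trisection.IsCurve S δ) :
    IsConnected δ := by
  obtain ⟨-, γ, hγ, hrange⟩ := hc
  haveI : ConnectedSpace (Metric.sphere (0 : EuclideanSpace ℝ (Fin 2)) 1) := by
    refine isConnected_iff_connectedSpace.mp (isConnected_sphere ?_ 0 zero_le_one)
    rw [← Module.finrank_eq_rank, finrank_euclideanSpace_fin]
    norm_num
  rw [← hrange]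
  exact isConnected_range hγ.contMDiff.continuous

/-- **The `π₁`-obstruction to a non-separating reducing curve, from side functions read in
flat charts of `(F, δ)`.**  See the module docstring.
[cite: ArandaZupan2025, §2 p. 6 (reducing curves, non-separating case)]
[cite: HatcherAT2002, Thm. 1.7 (p. 29)] -/
theorem IsGKTrisection.not_simplyConnectedSpace_of_sideCharts (h : IsGKTrisection X g k S)
    {δ : Set X} (hc : Trisection.IsCurve S δ) (hns : Trisection.IsNonSeparating S δ)
    (D : Fin 3 → Set X) (hDc : ∀ q, IsClosed (D q))
    (hDH : ∀ q, D q ⊆ Trisection.spineHandlebody S q)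
    (hDF : ∀ q, D q ∩ (⋂ l, S l) = δ)
    (O : Fin 3 → Set X) (hO : ∀ q, IsOpen (O q)) (hDO : ∀ q, D q ⊆ O q)
    (sd : Fin 3 → X → ℝ)
    (hsd : ∀ q, ∀ y ∈ (O q ∩ Trisection.spineHandlebody S q) \ D q,
      (sd q y = 1 ∨ sd q y = -1) ∧ ∀ᶠ z in 𝓝[Trisection.spineHandlebody S q] y, sd q z = sd q y)
    (hchart : ∀ p : ↥(⋂ l, S l), (p : X) ∈ δ →
      ∃ e : OpenPartialHomeomorph ↥(⋂ l, S l) (ℝ × ℝ), p ∈ e.source ∧ e p = 0 ∧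
        (∀ y ∈ e.source, (y : X) ∈ δ ↔ (e y).2 = 0) ∧
        ∀ q, ∃ ε : ℝ, (ε = 1 ∨ ε = -1) ∧ ∀ y ∈ e.source,
          (0 < (e y).2 → sd q y = ε) ∧ ((e y).2 < 0 → sd q y = -ε)) :
    ¬ SimplyConnectedSpace X := by
  classical
  -- elementary facts
  have hFH : ∀ q, (⋂ l, S l) ⊆ Trisection.spineHandlebody S q := fun q =>
    iInter_subset_spineHandlebody S q
  have hδF : δ ⊆ ⋂ l, S l := hc.1
  have hδD : ∀ q, δ ⊆ D q := fun q y hy => by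
    have : y ∈ D q ∩ ⋂ l, S l := by rw [hDF q]; exact hy
    exact this.1
  have hnotD : ∀ q, ∀ y ∈ ⋂ l, S l, y ∉ δ → y ∉ D q := fun q y hyF hyδ hyD => by
    have : y ∈ D q ∩ ⋂ l, S l := ⟨hyD, hyF⟩
    rw [hDF q] at this
    exact hyδ this
  have hsd1 : ∀ q, ∀ y ∈ ⋂ l, S l, y ∈ O q → y ∉ δ → sd q y = 1 ∨ sd q y = -1 :=
    fun q y hyF hyO hyδ => (hsd q y ⟨⟨hyO, hFH q hyF⟩, hnotD q y hyF hyδ⟩).1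
  -- the trace of `δ` on the subspace `F`
  set δF : Set ↥(⋂ l, S l) := Subtype.val ⁻¹' δ with hδFdef
  have himage : Subtype.val '' δF = δ := by
    ext y
    simp only [hδFdef, mem_image, mem_preimage]
    exact ⟨fun ⟨z, hz, hzy⟩ => hzy ▸ hz, fun hy => ⟨⟨y, hδF hy⟩, hy, rfl⟩⟩
  have hδFconn : IsPreconnected δF := by
    rw [← Topology.IsInducing.subtypeVal.isPreconnected_image, himage]
    exact hc.isConnected.isPreconnected
  -- `δ` is nowhere dense in `F` (read in a chart)
  have hnd : ∀ p ∈ δF, ∀ V ∈ 𝓝 p, (V \ δF).Nonempty := by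
    intro p hp V hV
    obtain ⟨e, hpe, hep, hδe, -⟩ := hchart p hp
    -- the image of `e.source ∩ V` is a neighbourhood of `0`
    have hV' : e.source ∩ interior V ∈ 𝓝 p :=
      inter_mem (e.open_source.mem_nhds hpe) (isOpen_interior.mem_nhds
        (mem_interior_iff_mem_nhds.2 hV))
    have himg : IsOpen (e '' (e.source ∩ interior V)) :=
      (e.isOpen_image_iff_of_subset_source inter_subset_left).2
        (e.open_source.inter isOpen_interior)
    have h0 : (0 : ℝ × ℝ) ∈ e '' (e.source ∩ interior V) :=
      ⟨p, ⟨hpe, mem_interior_iff_mem_nhds.2 hV⟩, hep⟩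
    obtain ⟨r, hr, hball⟩ := Metric.isOpen_iff.1 himg 0 h0
    have hz : ((0 : ℝ), r / 2) ∈ Metric.ball (0 : ℝ × ℝ) r := by
      rw [Metric.mem_ball, Prod.dist_eq, Real.dist_eq, Real.dist_eq]
      simp only [Prod.fst_zero, Prod.snd_zero, sub_zero, abs_zero]
      rw [abs_of_pos (by positivity)]
      exact max_lt hr (by linarith)
    obtain ⟨y, ⟨hye, hyV⟩, hyz⟩ := hball hz
    refine ⟨y, interior_subset hyV, fun hyδ => ?_⟩
    have h2 : (e y).2 = 0 := (hδe y hye).1 hyδ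
    rw [hyz] at h2
    simp only at h2
    linarith
  -- the compatibility neighbourhood, from the products `σ_q σ_0`
  have hcompat : ∀ q, ∃ Aq : Set ↥(⋂ l, S l), IsOpen Aq ∧ δF ⊆ Aq ∧ ∃ κ : ℝ,
      ∀ y ∈ Aq \ δF, sd q y * sd 0 y = κ := by
    intro q
    refine exists_open_forall_eq_of_local hδFconn hnd fun p hp => ?_
    obtain ⟨e, hpe, -, hδe, hε⟩ := hchart p hp
    obtain ⟨εq, -, hεq⟩ := hε q
    obtain ⟨ε0, -, hε0⟩ := hε 0
    refine ⟨e.source, e.open_source.mem_nhds hpe, εq * ε0, fun y hy => ?_⟩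
    have hne : (e y).2 ≠ 0 := fun h0 => hy.2 ((hδe y hy.1).2 h0)
    rcases lt_or_gt_of_ne hne with hlt | hgt
    · rw [(hεq y hy.1).2 hlt, (hε0 y hy.1).2 hlt]; ring
    · rw [(hεq y hy.1).1 hgt, (hε0 y hy.1).1 hgt]
  choose Aq hAqo hδAq κ hκ using hcompat
  set AF : Set ↥(⋂ l, S l) := ⋂ q, Aq q with hAF
  have hAFo : IsOpen AF := isOpen_iInter_of_finite hAqo
  obtain ⟨G, hGo, hGpre⟩ := isOpen_induced_iff.1 hAFo
  set A : Set X := G ∩ ⋂ q, O q with hAdef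
  have hAo : IsOpen A := hGo.inter (isOpen_iInter_of_finite hO)
  have hδA : δ ⊆ A := fun y hy => by
    refine ⟨?_, mem_iInter.2 fun q => hDO q (hδD q hy)⟩
    have : (⟨y, hδF hy⟩ : ↥(⋂ l, S l)) ∈ AF := mem_iInter.2 fun q => hδAq q hy
    rw [← hGpre] at this
    exact this
  have hAO : ∀ q, A ⊆ O q := fun q y hy => mem_iInter.1 hy.2 q
  have hAF_of_mem : ∀ y : ↥(⋂ l, S l), (y : X) ∈ A → y ∈ AF := fun y hy => by
    rw [← hGpre]; exact hy.1
  have hcomp : ∀ q, (∀ y ∈ (A ∩ ⋂ l, S l) \ δ, sd q y = sd 0 y) ∨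
      (∀ y ∈ (A ∩ ⋂ l, S l) \ δ, sd q y = -sd 0 y) := by
    intro q
    by_cases hκ1 : κ q = 1
    · refine Or.inl fun y hy => ?_
      have hyAF := hAF_of_mem ⟨y, hy.1.2⟩ hy.1.1
      have hprod := hκ q ⟨y, hy.1.2⟩ ⟨mem_iInter.1 hyAF q, hy.2⟩
      rw [hκ1] at hprod
      have h0 := hsd1 0 y hy.1.2 (hAO 0 hy.1.1) hy.2
      have hq := hsd1 q y hy.1.2 (hAO q hy.1.1) hy.2
      change sd q y * sd 0 y = 1 at hprod
      rcases h0 with h0 | h0 <;> rcases hq with hq | hq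
      · rw [h0, hq]
      · exfalso; rw [h0, hq] at hprod; norm_num at hprod
      · exfalso; rw [h0, hq] at hprod; norm_num at hprod
      · rw [h0, hq]
    · refine Or.inr fun y hy => ?_
      have hyAF := hAF_of_mem ⟨y, hy.1.2⟩ hy.1.1
      have hprod := hκ q ⟨y, hy.1.2⟩ ⟨mem_iInter.1 hyAF q, hy.2⟩
      have h0 := hsd1 0 y hy.1.2 (hAO 0 hy.1.1) hy.2
      have hq := hsd1 q y hy.1.2 (hAO q hy.1.1) hy.2
      change sd q y * sd 0 y = κ q at hprod
      rcases h0 with h0 | h0 <;> rcases hq with hq | hq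
      · exfalso; rw [h0, hq] at hprod; norm_num at hprod; exact hκ1 hprod.symm
      · rw [h0, hq]
      · rw [h0, hq]; norm_num
      · exfalso; rw [h0, hq] at hprod; norm_num at hprod; exact hκ1 hprod.symm
  -- the crossing arc, in a chart at a point of `δ`
  obtain ⟨p₀, hp₀⟩ := hc.nonempty
  obtain ⟨e, hpe, hep, hδe, hε⟩ := hchart ⟨p₀, hδF hp₀⟩ hp₀
  obtain ⟨ε, hε1, hεsd⟩ := hε 0
  -- a ball about `0` in the target over which the chart lands in `A`
  set T : Set (ℝ × ℝ) := e.target ∩ e.symm ⁻¹' (Subtype.val ⁻¹' A) with hT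
  have hTo : IsOpen T :=
    e.continuousOn_symm.isOpen_inter_preimage e.open_target (hAo.preimage continuous_subtype_val)
  have h0T : (0 : ℝ × ℝ) ∈ T := by
    refine ⟨hep ▸ e.map_source hpe, ?_⟩
    show ((e.symm 0 : ↥(⋂ l, S l)) : X) ∈ A
    rw [← hep, e.left_inv hpe]
    exact hδA hp₀
  obtain ⟨r, hr, hball⟩ := Metric.isOpen_iff.1 hTo 0 h0T
  -- the segment `s ↦ (0, ε (r/2) (2s - 1))`
  set z : I → ℝ × ℝ := fun s => ((0 : ℝ), ε * (r / 2) * (2 * (s : ℝ) - 1)) with hz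
  have hzc : Continuous z :=
    continuous_const.prodMk (continuous_const.mul
      ((continuous_const.mul continuous_subtype_val).sub continuous_const))
  have hεabs : |ε| = 1 := by rcases hε1 with h1 | h1 <;> simp [h1]
  have hzball : ∀ s, z s ∈ Metric.ball (0 : ℝ × ℝ) r := fun s => by
    rw [Metric.mem_ball, Prod.dist_eq, Real.dist_eq, Real.dist_eq]
    simp only [hz, Prod.fst_zero, Prod.snd_zero, sub_zero, abs_zero]
    refine max_lt hr ?_
    have hs : |2 * (s : ℝ) - 1| ≤ 1 := by
      rw [abs_le]; constructor <;> linarith [s.2.1, s.2.2]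
    calc |ε * (r / 2) * (2 * (s : ℝ) - 1)| = r / 2 * |2 * (s : ℝ) - 1| := by
          rw [abs_mul, abs_mul, hεabs, one_mul, abs_of_pos (by positivity)]
      _ ≤ r / 2 * 1 := by gcongr
      _ < r := by linarith
  have hzT : ∀ s, z s ∈ T := fun s => hball (hzball s)
  set α : Path (e.symm (z 0)) (e.symm (z 1)) :=
    { toFun := fun s => e.symm (z s)
      continuous_toFun := e.continuousOn_symm.comp_continuous hzc fun s => (hzT s).1
      source' := rfl
      target' := rfl } with hαdef
  have hα_apply : ∀ s, α s = e.symm (z s) := fun s => rfl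
  have hαsrc : ∀ s, α s ∈ e.source := fun s => e.map_target (hzT s).1
  have heα : ∀ s, e (α s) = z s := fun s => e.right_inv (hzT s).1
  have hαA : ∀ s, (α s : X) ∈ A := fun s => (hzT s).2
  set s₀ : I := ⟨1 / 2, by norm_num, by norm_num⟩ with hs₀def
  have hzs₀ : z s₀ = 0 := by
    simp only [hz, hs₀def]
    norm_num
  have hα₀ : (α s₀ : X) ∈ δ := by
    rw [hα_apply, hzs₀, ← hep, e.left_inv hpe]
    exact hp₀
  have hsecond : ∀ s : I, (e (α s)).2 = ε * (r / 2) * (2 * (s : ℝ) - 1) := fun s => by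
    rw [heα]
  have hαneg : ∀ s, s < s₀ → (α s : X) ∉ δ ∧ sd 0 (α s) = -1 := by
    intro s hs
    have hs' : 2 * (s : ℝ) - 1 < 0 := by
      have : (s : ℝ) < 1 / 2 := hs
      linarith
    have hne : (e (α s)).2 ≠ 0 := by
      rw [hsecond]
      rcases hε1 with h1 | h1 <;> rw [h1] <;> nlinarith
    refine ⟨fun hδ' => hne ((hδe _ (hαsrc s)).1 hδ'), ?_⟩
    rcases hε1 with h1 | h1
    · have hlt : (e (α s)).2 < 0 := by rw [hsecond, h1]; nlinarith
      rw [(hεsd _ (hαsrc s)).2 hlt, h1]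
    · have hgt : 0 < (e (α s)).2 := by rw [hsecond, h1]; nlinarith
      rw [(hεsd _ (hαsrc s)).1 hgt, h1]
  have hαpos : ∀ s, s₀ < s → (α s : X) ∉ δ ∧ sd 0 (α s) = 1 := by
    intro s hs
    have hs' : 0 < 2 * (s : ℝ) - 1 := by
      have : (1 / 2 : ℝ) < s := hs
      linarith
    have hne : (e (α s)).2 ≠ 0 := by
      rw [hsecond]
      rcases hε1 with h1 | h1 <;> rw [h1] <;> nlinarith
    refine ⟨fun hδ' => hne ((hδe _ (hαsrc s)).1 hδ'), ?_⟩
    rcases hε1 with h1 | h1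
    · have hgt : 0 < (e (α s)).2 := by rw [hsecond, h1]; nlinarith
      rw [(hεsd _ (hαsrc s)).1 hgt, h1]
    · have hlt : (e (α s)).2 < 0 := by rw [hsecond, h1]; nlinarith
      rw [(hεsd _ (hαsrc s)).2 hlt, h1]; norm_num
  exact h.not_simplyConnectedSpace_of_sideFunctions hc hns D hDc hDH hDF O hO hDO sd hsd A hAo
    hδA hAO hcomp α hαA s₀ ⟨by norm_num [hs₀def], by norm_num [hs₀def]⟩ hα₀ hαneg hαpos

end Charts

end Literature.Topology.FourManifolds

end
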